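/-
Copyright (c) 2026. All rights reserved.
Released under Apache 2.0 license as described in the file LICENSE.
-/
import Literature.Probability.FitznerVanDerHofstad2017.SrwIntegralMonotone
import Literature.Probability.FitznerVanDerHofstad2017.SrwIntegralSupFinite
import Literature.Probability.FitznerVanDerHofstad2017.SrwIntegralJCone
import HarnessLib

/-!
# Monotonicity of `W_{n,j}` and `L_n` in the SORTED order ([HS92b] Lemma B.4) and the
  finite node families of the sup cells

[HS92b] T. Hara, G. Slade, *The lace expansion for self-avoiding walk in five or more dimensions*,
Rev. Math. Phys. **4** (1992) 235–327, Appendix B, Lemma B.4 (p. 102 of the journal offprint):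

> For `n ≥ 1` let `x, z ∈ ℤ^d` with `x₁ ≥ x₂ ≥ … ≥ x_d ≥ 0`, `z₁ ≥ … ≥ z_d ≥ 0`.  Then in the notation
> (B.21), `L_n(x + z) ≤ L_n(x)`.  Moreover for any fixed `J ≥ 0`,
> `sup {L_n(x) : ‖x‖_∞ > J} ≤ max {L_n(x) : ‖x‖_∞ = J}`.

Its printed proof: the orbit formula (B.21) `L_n(x) = (d! 2^d)⁻¹ Σ_{(ν,δ)} I_{n,0}(x - p(x;ν,δ))`,
Lemma B.3 (monotonicity of `I_{n,0}` in each `|x_μ|`) and the integer inequality (B.30)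
`|x_μ - δ_μ x_{ν(μ)}| ≤ |x'_μ - δ_μ x'_{ν(μ)}|`, `x' = x + z` ((B.31)–(B.32)).

This module KERNEL-PROVES Lemma B.4 and GENERALISES it to every `W_{n,j}`
([NoBLE17] (5.16): `W_{n,j}(x) = (d! 2^d)⁻¹ Σ I_{n,2j}(x - p(x;ν,δ))`), since all three ingredients
are in the tree for every `l`: `srwW_eq_orbit_sum` ((B.21)/(5.16)), `absMonotone_srwI` (B.3 for all
`I_{n,l}`, `n ≥ 1`, `d ≥ 2n+1`) and (B.30) is `abs_sub_spAct_le_of_antitone` below: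

* `srwW_add_le_of_antitone` : `W_{n,j}(x + z) ≤ W_{n,j}(x)` for `x, z` sorted non-increasing and
  non-negative (`n ≥ 1`, `d ≥ 2n+1`, every `j ≥ 0`); `srwL_add_le_of_antitone` is the case `j = 0`,
  i.e. [HS92b] Lemma B.4 = [NoBLE17] Lemma 5.1, `L`-clause ("for all `n ≥ 0`, `x ↦ L_n(x)` [is]
  monotone decreasing in `|x_ι|`", PTRF **167** (2017) p. 1093) in the form in which it is TRUE —
  the coordinatewise reading is false (`L₁(2e₁+2e₂) > L₁(2e₁+e₂)` at `d = 11`, b2b-lace REFEREE2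
  §AC2), and so is `n = 0` (`L₀(x) = 1/|orbit(x)|`);
* `exists_le_of_linfty_gt` : the "Moreover" clause, for every `W_d`-invariant sorted-antitone `F`.

This discharges, in sorted form, the hypothesis `hW` of `srwK_le_sqrt_of_srwW_le`
(`SrwIntegralWSplit`: "for `j ≥ 1` NOT in print and NOT proved here").

## The finite node families (exact minimal elements of the sorted order)

For a `W_d`-invariant `F : ℤ^d → ℝ` that is antitone in the sorted order
(`F (x + z) ≤ F x` for sorted non-negative `x, z`) the sup over a symmetric cell is attained on the
MINIMAL sorted vectors of the cell, and these are finitely many explicit nodes: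

* `x ≠ 0`            : `F x ≤ F(1^r)`, `r = ` support size of `x` (`le_onesVec_of_sortedAntitone`);
* `‖x‖₁ ≥ 2`         : nodes `2e₁` and `1^r` (`2 ≤ r ≤ d`) (`le_of_nodeBounds_two`);
* `‖x‖₁ ≥ 3` (`= Q`) : nodes `3e₁, 2e₁+e₂, 2e₁+2e₂` and `1^r` (`3 ≤ r ≤ d`) (`le_of_nodeBounds_three`);
* `‖x‖_∞ > J`        : the box shell `‖w‖_∞ = J`, `w ≥ 0` (`exists_le_of_linfty_gt`).

The nodes `1^r` (`r ≥ 2`) and `2e₁+2e₂` are minimal in the sorted order (a sorted non-negative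
`z ≠ 0` has `z₁ ≥ 1`), so they cannot be removed by Lemma B.4: the printed sentence "the supremum
over `Q` is the maximum over the three points `3e₁, 2e₁+e₂, e₁+e₂+e₃`" ([NoBLE17] p. 1093) needs,
beyond Lemma 5.1, the comparisons `F(1^r) ≤ …` (`r ≥ 4`) and `F(2e₁+2e₂) ≤ …`, which are NOT
consequences of the lemma (`L₀(1^r) = (2^r C(d,r))⁻¹` is not even monotone in `r`).  The theorems
below therefore carry the full node family as hypotheses; instantiated for `W_{n,j}`, `L_n` and, via
Cauchy–Schwarz (`srwK_le_sqrt_of_srwW_le`), for `K_{n,m+j}` (§5).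

Everything here is `d`-generic; no numeral of any dimension occurs.  Nothing in this file is a cited
hypothesis: every statement is proved.
-/

namespace Literature.Probability.FitznerVanDerHofstad2017

open Finset Real

variable {d : ℕ}

/-! ### §1  The integer inequality (B.30)–(B.32) -/

/-- [HS92b] (B.30): for `x, z` sorted non-increasing and non-negative, `x' = x + z`, every signed
permutation `(ν, δ)` and every `μ`: `|x_μ - δ_μ x_{ν μ}| ≤ |x'_μ - δ_μ x'_{ν μ}|`
((B.31): `δ_μ = -1`, sums of non-negatives; (B.32): `δ_μ = +1`, sorted `z` widens sorted gaps).
[cite: HaraSlade1992b, App. B, Lemma B.4, (B.30)–(B.32)] -/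
theorem abs_sub_spAct_le_of_antitone (x z : Fin d → ℤ) (hx : Antitone x) (hx0 : ∀ i, 0 ≤ x i)
    (hz : Antitone z) (hz0 : ∀ i, 0 ≤ z i) (σ : SgnPermPair d) (μ : Fin d) :
    |(x - spAct σ x) μ| ≤ |((x + z) - spAct σ (x + z)) μ| := by
  simp only [Pi.sub_apply, Pi.add_apply, spAct_apply]
  set ν := σ.1 μ with hν
  have hxμ := hx0 μ
  have hxν := hx0 ν
  have hzμ := hz0 μ
  have hzν := hz0 ν
  rcases Int.units_eq_one_or (σ.2 μ) with h | h
  · -- `δ_μ = +1`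
    rw [h, Units.val_one, one_mul, one_mul]
    rcases le_total μ ν with hle | hle
    · have h1 : x ν ≤ x μ := hx hle
      have h2 : z ν ≤ z μ := hz hle
      rw [abs_of_nonneg (by linarith), abs_of_nonneg (by linarith)]
      linarith
    · have h1 : x μ ≤ x ν := hx hle
      have h2 : z μ ≤ z ν := hz hle
      rw [abs_of_nonpos (by linarith), abs_of_nonpos (by linarith)]
      linarith
  · -- `δ_μ = -1`
    rw [h, Units.val_neg, Units.val_one, neg_mul, one_mul, neg_mul, one_mul, sub_neg_eq_add,
      sub_neg_eq_add, abs_of_nonneg (by linarith), abs_of_nonneg (by linarith)]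
    linarith

/-! ### §2  Orbit sums of an `AbsMonotone` function -/

/-- For `f` monotone under coordinatewise domination of absolute values ([HS92b] B.3-shape) and
`x, z` sorted non-negative: `Σ_{σ ∈ W_d} f((x+z) - σ(x+z)) ≤ Σ_{σ ∈ W_d} f(x - σ x)` (termwise, by
(B.30)). [cite: HaraSlade1992b, App. B, proof of Lemma B.4] -/
theorem sum_spAct_add_le_of_antitone (f : (Fin d → ℤ) → ℝ) (hf : AbsMonotone f)
    (x z : Fin d → ℤ) (hx : Antitone x) (hx0 : ∀ i, 0 ≤ x i) (hz : Antitone z)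
    (hz0 : ∀ i, 0 ≤ z i) :
    ∑ σ : SgnPermPair d, f ((x + z) - spAct σ (x + z)) ≤
      ∑ σ : SgnPermPair d, f (x - spAct σ x) :=
  Finset.sum_le_sum fun σ _ =>
    hf _ _ fun μ => abs_sub_spAct_le_of_antitone x z hx hx0 hz hz0 σ μ

/-! ### §3  [HS92b] Lemma B.4 for every `W_{n,j}` and for `L_n` -/

/-- Sorted-order monotonicity of `W_{n,j}` from the B.3-shaped hypothesis on `I_{n,2j}` (any `n`).
[cite: HaraSlade1992b, App. B, Lemma B.4] -/
theorem srwW_add_le_of_antitone_of_absMonotone {n : ℕ} (hd : 2 * n + 1 ≤ d) (j : ℕ)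
    (hmono : AbsMonotone (srwI d n (2 * j))) (x z : Fin d → ℤ) (hx : Antitone x)
    (hx0 : ∀ i, 0 ≤ x i) (hz : Antitone z) (hz0 : ∀ i, 0 ≤ z i) :
    srwW d n j (x + z) ≤ srwW d n j x := by
  rw [srwW_eq_orbit_sum hd j (x + z), srwW_eq_orbit_sum hd j x]
  exact div_le_div_of_nonneg_right
    (sum_spAct_add_le_of_antitone _ hmono x z hx hx0 hz hz0) (by positivity)

/-- **[HS92b] Lemma B.4, generalised to every `W_{n,j}`** (`n ≥ 1`, `d ≥ 2n+1`, all `j ≥ 0`):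
for `x, z ∈ ℤ^d` sorted non-increasing and non-negative, `W_{n,j}(x + z) ≤ W_{n,j}(x)`.
This is the sorted (true) form of the `W`-monotonicity that [NoBLE17] p. 1096 uses implicitly
("we use `x₁ ≥ x₂ ≥ 0` and Lemma 5.1"); unconditional.
[cite: HaraSlade1992b, App. B, Lemma B.4; FitznerVanDerHofstad2016NoBLE, (5.16) and Lemma 5.1 p. 1093] -/
theorem srwW_add_le_of_antitone {n : ℕ} (hn : 1 ≤ n) (hd : 2 * n + 1 ≤ d) (j : ℕ)
    (x z : Fin d → ℤ) (hx : Antitone x) (hx0 : ∀ i, 0 ≤ x i) (hz : Antitone z)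
    (hz0 : ∀ i, 0 ≤ z i) :
    srwW d n j (x + z) ≤ srwW d n j x :=
  srwW_add_le_of_antitone_of_absMonotone hd j (absMonotone_srwI hn hd (2 * j)) x z hx hx0 hz hz0

/-- **[HS92b] Lemma B.4** = [NoBLE17] Lemma 5.1, `L`-clause, in its printed ([HS92b]) sorted form:
`L_n(x + z) ≤ L_n(x)` for `x, z` sorted non-increasing and non-negative (`n ≥ 1`, `d ≥ 2n+1`).
[cite: HaraSlade1992b, App. B, Lemma B.4; FitznerVanDerHofstad2016NoBLE, Lemma 5.1 p. 1093] -/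
theorem srwL_add_le_of_antitone {n : ℕ} (hn : 1 ≤ n) (hd : 2 * n + 1 ≤ d)
    (x z : Fin d → ℤ) (hx : Antitone x) (hx0 : ∀ i, 0 ≤ x i) (hz : Antitone z)
    (hz0 : ∀ i, 0 ≤ z i) :
    srwL d n (x + z) ≤ srwL d n x := by
  rw [← srwW_zero, ← srwW_zero]
  exact srwW_add_le_of_antitone hn hd 0 x z hx hx0 hz hz0

/-- The Cauchy–Schwarz consequence for `K` ([NoBLE17] (5.28)–(5.29) shape): for `x, z` sorted
non-negative, `K_{n,m+j}(x + z) ≤ √I_{n,2m}(0) · √W_{n,j}(x)`.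
[cite: FitznerVanDerHofstad2016NoBLE, (5.28)–(5.29) p. 1093] -/
theorem srwK_add_le_sqrt_of_antitone {n : ℕ} (hn : 1 ≤ n) (hd : 2 * n + 1 ≤ d) (m j : ℕ)
    (x z : Fin d → ℤ) (hx : Antitone x) (hx0 : ∀ i, 0 ≤ x i) (hz : Antitone z)
    (hz0 : ∀ i, 0 ≤ z i) :
    srwK d n (m + j) (x + z) ≤ Real.sqrt (srwI d n (2 * m) 0) * Real.sqrt (srwW d n j x) :=
  srwK_le_sqrt_of_srwW_le hd m j (x + z) (srwW_add_le_of_antitone hn hd j x z hx hx0 hz hz0)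

/-! ### §4  Sorted reduction to finite node families (abstract `F`) -/

/-- `F` is invariant under the hyperoctahedral group `W_d`. [folklore] -/
def SpInvariant (F : (Fin d → ℤ) → ℝ) : Prop := ∀ (τ : SgnPermPair d) (x : Fin d → ℤ), F (spAct τ x) = F x

/-- `F` is antitone in the SORTED order: `F (x + z) ≤ F x` for `x, z` sorted non-increasing and
non-negative ([HS92b] Lemma B.4 shape). [cite: HaraSlade1992b, App. B, Lemma B.4] -/
def SortedAntitone (F : (Fin d → ℤ) → ℝ) : Prop :=
  ∀ x z : Fin d → ℤ, Antitone x → (∀ i, 0 ≤ x i) → Antitone z → (∀ i, 0 ≤ z i) → F (x + z) ≤ F x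

/-- `W_{n,j}` is `W_d`-invariant. [cite: FitznerVanDerHofstad2016NoBLE, (5.16) p. 1093] -/
theorem spInvariant_srwW (n j : ℕ) : SpInvariant (srwW d n j) := fun τ x => srwW_spAct n j τ x

/-- `L_n` is `W_d`-invariant. [cite: FitznerVanDerHofstad2016NoBLE, (2.19) p. 1058] -/
theorem spInvariant_srwL (n : ℕ) : SpInvariant (srwL d n) := fun τ x => by
  rw [← srwW_zero, ← srwW_zero, srwW_spAct]

/-- `W_{n,j}` is sorted-antitone (`n ≥ 1`, `d ≥ 2n+1`). [cite: HaraSlade1992b, App. B, Lemma B.4] -/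
theorem sortedAntitone_srwW {n : ℕ} (hn : 1 ≤ n) (hd : 2 * n + 1 ≤ d) (j : ℕ) :
    SortedAntitone (srwW d n j) := fun x z hx hx0 hz hz0 =>
  srwW_add_le_of_antitone hn hd j x z hx hx0 hz hz0

/-- `L_n` is sorted-antitone (`n ≥ 1`, `d ≥ 2n+1`). [cite: HaraSlade1992b, App. B, Lemma B.4] -/
theorem sortedAntitone_srwL {n : ℕ} (hn : 1 ≤ n) (hd : 2 * n + 1 ≤ d) :
    SortedAntitone (srwL d n) := fun x z hx hx0 hz hz0 =>
  srwL_add_le_of_antitone hn hd x z hx hx0 hz hz0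

/-- Sorting: every `x` has a `W_d`-image that is sorted non-increasing, non-negative, with the same
`ℓ¹`-norm, and non-zero iff `x` is. [folklore] -/
theorem exists_spAct_sorted (x : Fin d → ℤ) :
    ∃ τ : SgnPermPair d, Antitone (spAct τ x) ∧ (∀ j, 0 ≤ spAct τ x j) ∧
      (∑ j, spAct τ x j = ∑ j, |x j|) ∧ (∀ j, spAct τ x j = |x (τ.1 j)|) := by
  obtain ⟨τ, hanti, -, habs⟩ :=
    exists_spAct_antitone_ge x (fun _ => 0) antitone_const fun j => abs_nonneg _
  refine ⟨τ, hanti, fun j => by rw [habs]; exact abs_nonneg _, ?_, habs⟩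
  rw [show (∑ j, spAct τ x j) = ∑ j, |x (τ.1 j)| from Finset.sum_congr rfl fun j _ => habs j]
  exact Equiv.sum_comp τ.1 (fun j => |x j|)

/-- The all-ones vector on the first `r` coordinates: `1^r 0^{d-r} = classVec d r 0`. [folklore] -/
theorem classVec_zero_right_apply (r : ℕ) (μ : Fin d) :
    classVec d r 0 μ = if (μ : ℕ) < r then 1 else 0 := by
  simp only [classVec, add_zero]
  split_ifs <;> rfl

/-- A sorted non-negative vector is `≥ 1` exactly on an initial segment `{μ < r}`, where `r` is its
support size. [folklore] -/
theorem support_initial_of_antitone (y : Fin d → ℤ) (hy : Antitone y) (hy0 : ∀ i, 0 ≤ y i) :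
    (∀ μ : Fin d, (μ : ℕ) < suppCount y → 1 ≤ y μ) ∧
      (∀ μ : Fin d, suppCount y ≤ (μ : ℕ) → y μ = 0) := by
  classical
  -- the support is a lower set
  have hlower : ∀ μ ν : Fin d, μ ≤ ν → y ν ≠ 0 → y μ ≠ 0 := by
    intro μ ν hμν hν hμ
    have h1 : y ν ≤ y μ := hy hμν
    have h2 := hy0 ν
    exact hν (le_antisymm (hμ ▸ h1) h2)
  have key : ∀ μ : Fin d, (μ : ℕ) < suppCount y ↔ y μ ≠ 0 := fun μ => by
    unfold suppCount
    exact Fin.lt_card_filter_univ_iff_apply_of_imp (fun μ => y μ ≠ 0)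
      (fun i j hji hi => hlower j i hji hi)
  constructor
  · intro μ hμ
    have h1 := (key μ).mp hμ
    have h2 := hy0 μ
    omega
  · intro μ hμ
    by_contra hne
    have := (key μ).mpr hne
    omega

/-- **Support node.**  A sorted non-negative `y ≠ 0` with support size `r` is `1^r + z` with `z`
sorted non-negative; hence `F y ≤ F(1^r)`. [cite: HaraSlade1992b, App. B, Lemma B.4] -/
theorem le_classVec_suppCount_of_antitone (F : (Fin d → ℤ) → ℝ) (hF : SortedAntitone F)
    (y : Fin d → ℤ) (hy : Antitone y) (hy0 : ∀ i, 0 ≤ y i) :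
    F y ≤ F (classVec d (suppCount y) 0) := by
  obtain ⟨hpos, hzero⟩ := support_initial_of_antitone y hy hy0
  set r := suppCount y with hr
  set z : Fin d → ℤ := fun μ => y μ - classVec d r 0 μ with hz
  have hyz : y = classVec d r 0 + z := by
    funext μ; simp [hz]
  have hz0 : ∀ μ, 0 ≤ z μ := by
    intro μ
    simp only [hz, classVec_zero_right_apply]
    split_ifs with h
    · have := hpos μ h; omega
    · have := hy0 μ; omega
  have hza : Antitone z := by
    intro μ ν hμν
    have hμν' : (μ : ℕ) ≤ (ν : ℕ) := hμν
    have hyμν : y ν ≤ y μ := hy hμν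
    simp only [hz, classVec_zero_right_apply]
    split_ifs with h1 h2 h2
    · omega
    · omega
    · have := hzero ν (by omega); have := hpos μ h2; omega
    · omega
  have hca : Antitone (classVec d r 0) := by
    intro μ ν hμν
    have hμν' : (μ : ℕ) ≤ (ν : ℕ) := hμν
    simp only [classVec_zero_right_apply]
    split_ifs <;> omega
  have hc0 : ∀ μ, 0 ≤ classVec d r 0 μ := by
    intro μ; simp only [classVec_zero_right_apply]; split_ifs <;> omega
  rw [hyz]
  exact hF _ _ hca hc0 hza hz0

/-- `1 ≤ suppCount y ≤ d` for a non-zero `y`. [folklore] -/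
theorem one_le_suppCount (y : Fin d → ℤ) (hy : y ≠ 0) : 1 ≤ suppCount y := by
  classical
  by_contra h
  apply hy
  funext μ
  have h0 : suppCount y = 0 := by omega
  unfold suppCount at h0
  rw [Finset.card_eq_zero, Finset.filter_eq_empty_iff] at h0
  simpa using h0 (mem_univ μ)

/-- Values of `vecOfParts d [a]`. [folklore] -/
theorem vecOfParts_single_apply (a : ℕ) (μ : Fin d) :
    vecOfParts d [a] μ = if (μ : ℕ) = 0 then (a : ℤ) else 0 := by
  simp only [vecOfParts]
  split_ifs with h
  · simp [h]
  · obtain ⟨k, hk⟩ : ∃ k, (μ : ℕ) = k + 1 := ⟨(μ : ℕ) - 1, by omega⟩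
    simp [hk]

/-- Values of `vecOfParts d [a, b]`. [folklore] -/
theorem vecOfParts_pair_apply (a b : ℕ) (μ : Fin d) :
    vecOfParts d [a, b] μ =
      if (μ : ℕ) = 0 then (a : ℤ) else if (μ : ℕ) = 1 then (b : ℤ) else 0 := by
  simp only [vecOfParts]
  split_ifs with h h'
  · simp [h]
  · simp [h']
  · obtain ⟨k, hk⟩ : ∃ k, (μ : ℕ) = k + 2 := ⟨(μ : ℕ) - 2, by omega⟩
    simp [hk]

/-- The `ℓ¹`-norm of a sorted non-negative vector with support size `1` sits in coordinate `0`: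
`y = (Σ y) e₀`, written as `vecOfParts d [a]`. [folklore] -/
theorem eq_vecOfParts_single_of_suppCount_eq_one (y : Fin d → ℤ) (hy : Antitone y)
    (hy0 : ∀ i, 0 ≤ y i) (h1 : suppCount y = 1) :
    ∃ a : ℕ, 1 ≤ a ∧ (∑ j, y j) = a ∧ y = vecOfParts d [a] := by
  obtain ⟨hpos, hzero⟩ := support_initial_of_antitone y hy hy0
  have hd : 1 ≤ d := by have := suppCount_le y; omega
  let e0 : Fin d := ⟨0, by omega⟩
  have he0 : (e0 : ℕ) = 0 := rfl
  have ha : 1 ≤ y e0 := hpos e0 (by rw [he0, h1]; exact Nat.one_pos)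
  have hval : ∀ μ : Fin d, y μ = if (μ : ℕ) = 0 then y e0 else 0 := by
    intro μ
    split_ifs with h
    · rw [show μ = e0 from Fin.ext (by rw [he0]; exact h)]
    · exact hzero μ (by rw [h1]; omega)
  have hto : ((y e0).toNat : ℤ) = y e0 := Int.toNat_of_nonneg (by omega)
  refine ⟨(y e0).toNat, by omega, ?_, ?_⟩
  · rw [Fintype.sum_eq_single e0 fun μ hμ => ?_, hto]
    rw [hval μ, if_neg fun h => hμ (Fin.ext (by rw [he0]; exact h))]
  · funext μ
    rw [hval μ, vecOfParts_single_apply, hto]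

/-- `vecOfParts d [a]` with `a ≤ a'`: `F(a' e₀) ≤ F(a e₀)` (sorted decomposition
`a' e₀ = a e₀ + (a' - a) e₀`). [cite: HaraSlade1992b, App. B, Lemma B.4] -/
theorem le_vecOfParts_single_of_le (F : (Fin d → ℤ) → ℝ) (hF : SortedAntitone F) (a a' : ℕ)
    (h : a ≤ a') : F (vecOfParts d [a']) ≤ F (vecOfParts d [a]) := by
  have hdec : vecOfParts d [a'] = vecOfParts d [a] + vecOfParts d [a' - a] := by
    funext μ
    simp only [Pi.add_apply, vecOfParts_single_apply]
    split_ifs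
    · omega
    · rfl
  have hanti : ∀ c : ℕ, Antitone (vecOfParts d [c]) := by
    intro c μ ν hμν
    have hμν' : (μ : ℕ) ≤ (ν : ℕ) := hμν
    simp only [vecOfParts_single_apply]
    split_ifs
    · rfl
    · omega
    · positivity
    · rfl
  have hnn : ∀ (c : ℕ) (μ : Fin d), 0 ≤ vecOfParts d [c] μ := by
    intro c μ; simp only [vecOfParts_single_apply]; split_ifs <;> positivity
  rw [hdec]
  exact hF _ _ (hanti a) (hnn a) (hanti _) (hnn _)

/-- **Support size two.**  A sorted non-negative `y = (a, b, 0, …)`, `a ≥ b ≥ 1`, `a + b ≥ 3`, is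
`(2,1,0,…) + z` (if `a > b`) or `(2,2,0,…) + z` (if `a = b ≥ 2`) with `z` sorted non-negative.
[cite: HaraSlade1992b, App. B, Lemma B.4] -/
theorem le_pair_nodes_of_suppCount_eq_two (F : (Fin d → ℤ) → ℝ) (hF : SortedAntitone F)
    (y : Fin d → ℤ) (hy : Antitone y) (hy0 : ∀ i, 0 ≤ y i) (h2 : suppCount y = 2)
    (h3 : 3 ≤ ∑ j, y j) :
    F y ≤ max (F (vecOfParts d [2, 1])) (F (vecOfParts d [2, 2])) := by
  obtain ⟨hpos, hzero⟩ := support_initial_of_antitone y hy hy0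
  have hd : 2 ≤ d := by have := suppCount_le y; omega
  let e0 : Fin d := ⟨0, by omega⟩
  let e1 : Fin d := ⟨1, by omega⟩
  have he0 : (e0 : ℕ) = 0 := rfl
  have he1 : (e1 : ℕ) = 1 := rfl
  have ha : 1 ≤ y e0 := hpos e0 (by rw [he0, h2]; omega)
  have hb : 1 ≤ y e1 := hpos e1 (by rw [he1, h2]; omega)
  have hab : y e1 ≤ y e0 := hy (show e0 ≤ e1 from by rw [Fin.le_def, he0, he1]; omega)
  have hrest : ∀ μ : Fin d, 2 ≤ (μ : ℕ) → y μ = 0 := fun μ hμ => hzero μ (by omega)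
  have hval : ∀ μ : Fin d,
      y μ = if (μ : ℕ) = 0 then y e0 else if (μ : ℕ) = 1 then y e1 else 0 := by
    intro μ
    split_ifs with h h'
    · rw [show μ = e0 from Fin.ext (by rw [he0]; exact h)]
    · rw [show μ = e1 from Fin.ext (by rw [he1]; exact h')]
    · exact hrest μ (by omega)
  -- the sum is `y e0 + y e1`
  have hsum : ∑ j, y j = y e0 + y e1 := by
    refine Fintype.sum_eq_add e0 e1 (Fin.ne_of_val_ne (by rw [he0, he1]; omega)) ?_
    rintro c ⟨hc0, hc1⟩
    rw [hval c, if_neg fun h => hc0 (Fin.ext (by rw [he0]; exact h)),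
      if_neg fun h => hc1 (Fin.ext (by rw [he1]; exact h))]
  rw [hsum] at h3
  have hpanti : ∀ p q : ℕ, q ≤ p → Antitone (vecOfParts d [p, q]) := by
    intro p q hpq μ ν hμν
    have hμν' : (μ : ℕ) ≤ (ν : ℕ) := hμν
    simp only [vecOfParts_pair_apply]
    split_ifs <;> omega
  have hpnn : ∀ (p q : ℕ) (μ : Fin d), 0 ≤ vecOfParts d [p, q] μ := by
    intro p q μ; simp only [vecOfParts_pair_apply]; split_ifs <;> positivity
  rcases lt_or_eq_of_le hab with hlt | heq
  · -- `a > b`: `y = (2,1) + (a-2, b-1)`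
    refine le_trans ?_ (le_max_left _ _)
    set z : Fin d → ℤ := fun μ => y μ - vecOfParts d [2, 1] μ with hz
    have hyz : y = vecOfParts d [2, 1] + z := by funext μ; simp [hz]
    have hz0 : ∀ μ, 0 ≤ z μ := by
      intro μ; simp only [hz, vecOfParts_pair_apply]; rw [hval μ]
      split_ifs <;> push_cast <;> omega
    have hza : Antitone z := by
      intro μ ν hμν
      have hμν' : (μ : ℕ) ≤ (ν : ℕ) := hμν
      simp only [hz, vecOfParts_pair_apply]; rw [hval μ, hval ν]
      split_ifs <;> push_cast <;> omega
    rw [hyz]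
    exact hF _ _ (hpanti 2 1 (by norm_num)) (hpnn 2 1) hza hz0
  · -- `a = b ≥ 2`: `y = (2,2) + (a-2, a-2)`
    refine le_trans ?_ (le_max_right _ _)
    set z : Fin d → ℤ := fun μ => y μ - vecOfParts d [2, 2] μ with hz
    have hyz : y = vecOfParts d [2, 2] + z := by funext μ; simp [hz]
    have hz0 : ∀ μ, 0 ≤ z μ := by
      intro μ; simp only [hz, vecOfParts_pair_apply]; rw [hval μ]
      split_ifs <;> push_cast <;> omega
    have hza : Antitone z := by
      intro μ ν hμν
      have hμν' : (μ : ℕ) ≤ (ν : ℕ) := hμν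
      simp only [hz, vecOfParts_pair_apply]; rw [hval μ, hval ν]
      split_ifs <;> push_cast <;> omega
    rw [hyz]
    exact hF _ _ (hpanti 2 2 le_rfl) (hpnn 2 2) hza hz0

/-- **Cell `x ≠ 0`: the support family `{1^r : 1 ≤ r ≤ d}`** (`1^1 = e₁`).  For `F` `W_d`-invariant
and sorted-antitone, `F x ≤ max_r F(1^r)`. [cite: HaraSlade1992b, App. B, Lemma B.4] -/
theorem le_of_onesBounds (F : (Fin d → ℤ) → ℝ) (hI : SpInvariant F) (hF : SortedAntitone F)
    (B : ℝ) (hB : ∀ r : ℕ, 1 ≤ r → r ≤ d → F (classVec d r 0) ≤ B)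
    (x : Fin d → ℤ) (hx : x ≠ 0) : F x ≤ B := by
  obtain ⟨τ, hanti, hnn, -, -⟩ := exists_spAct_sorted x
  have hy : spAct τ x ≠ 0 := fun h => hx ((spAct_eq_zero_iff τ x).mp h)
  rw [← hI τ x]
  exact (le_classVec_suppCount_of_antitone F hF _ hanti hnn).trans
    (hB _ (one_le_suppCount _ hy) (suppCount_le _))

/-- **Cell `‖x‖₁ ≥ 2`: nodes `2e₁` and `1^r` (`2 ≤ r ≤ d`).**
[cite: HaraSlade1992b, App. B, Lemma B.4; FitznerVanDerHofstad2016NoBLE, §5.2 p. 1096] -/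
theorem le_of_nodeBounds_two (F : (Fin d → ℤ) → ℝ) (hI : SpInvariant F) (hF : SortedAntitone F)
    (B : ℝ) (h2 : F (vecOfParts d [2]) ≤ B)
    (hB : ∀ r : ℕ, 2 ≤ r → r ≤ d → F (classVec d r 0) ≤ B)
    (x : Fin d → ℤ) (hx : 2 ≤ ∑ j, |x j|) : F x ≤ B := by
  obtain ⟨τ, hanti, hnn, hsum, -⟩ := exists_spAct_sorted x
  rw [← hI τ x]
  rw [← hsum] at hx
  set y := spAct τ x with hydef
  have hy : y ≠ 0 := by
    intro h; rw [h] at hx; simp at hx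
  have hr1 := one_le_suppCount y hy
  rcases Nat.lt_or_ge 1 (suppCount y) with hr2 | hr1'
  · exact (le_classVec_suppCount_of_antitone F hF y hanti hnn).trans (hB _ hr2 (suppCount_le _))
  · have h1 : suppCount y = 1 := le_antisymm hr1' hr1
    obtain ⟨a, ha, hsa, hya⟩ := eq_vecOfParts_single_of_suppCount_eq_one y hanti hnn h1
    rw [hsa] at hx
    rw [hya]
    exact (le_vecOfParts_single_of_le F hF 2 a (by exact_mod_cast hx)).trans h2

/-- **Cell `Q = {‖x‖₁ ≥ 3}`: nodes `3e₁`, `2e₁+e₂`, `2e₁+2e₂` and `1^r` (`3 ≤ r ≤ d`).**  This is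
the exact content of "it suffices to consider the minimal elements of `Q`": the printed three points
`3e₁, 2e₁+e₂, e₁+e₂+e₃` ([NoBLE17] p. 1093) plus the sorted-minimal nodes `2e₁+2e₂` and `1^r`
(`r ≥ 4`) that Lemma 5.1 does not remove.
[cite: FitznerVanDerHofstad2016NoBLE, §5.1 p. 1093; HaraSlade1992b, App. B, Lemma B.4] -/
theorem le_of_nodeBounds_three (F : (Fin d → ℤ) → ℝ) (hI : SpInvariant F)
    (hF : SortedAntitone F) (B : ℝ) (h3 : F (vecOfParts d [3]) ≤ B)
    (h21 : F (vecOfParts d [2, 1]) ≤ B) (h22 : F (vecOfParts d [2, 2]) ≤ B)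
    (hB : ∀ r : ℕ, 3 ≤ r → r ≤ d → F (classVec d r 0) ≤ B)
    (x : Fin d → ℤ) (hx : 3 ≤ ∑ j, |x j|) : F x ≤ B := by
  obtain ⟨τ, hanti, hnn, hsum, -⟩ := exists_spAct_sorted x
  rw [← hI τ x]
  rw [← hsum] at hx
  set y := spAct τ x with hydef
  have hy : y ≠ 0 := by
    intro h; rw [h] at hx; simp at hx
  have hr1 := one_le_suppCount y hy
  rcases Nat.lt_or_ge 2 (suppCount y) with hr3 | hr2
  · exact (le_classVec_suppCount_of_antitone F hF y hanti hnn).trans (hB _ hr3 (suppCount_le _))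
  · rcases Nat.lt_or_ge 1 (suppCount y) with hr2' | hr1'
    · have h2 : suppCount y = 2 := by omega
      exact (le_pair_nodes_of_suppCount_eq_two F hF y hanti hnn h2 hx).trans (max_le h21 h22)
    · have h1 : suppCount y = 1 := by omega
      obtain ⟨a, ha, hsa, hya⟩ := eq_vecOfParts_single_of_suppCount_eq_one y hanti hnn h1
      rw [hsa] at hx
      rw [hya]
      exact (le_vecOfParts_single_of_le F hF 3 a (by exact_mod_cast hx)).trans h3

/-- **[HS92b] Lemma B.4, "Moreover" clause**, for every `W_d`-invariant sorted-antitone `F`: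
if `‖x‖_∞ > J ≥ 0` then `F x ≤ F w` for some `w ≥ 0` with `‖w‖_∞ = J`
(`w = min(x↓, J)` coordinatewise, `x↓` the sorted rearrangement of `|x|`).
[cite: HaraSlade1992b, App. B, Lemma B.4] -/
theorem exists_le_of_linfty_gt (F : (Fin d → ℤ) → ℝ) (hI : SpInvariant F) (hF : SortedAntitone F)
    (J : ℤ) (hJ : 0 ≤ J) (x : Fin d → ℤ) (hx : ∃ i, J < |x i|) :
    ∃ w : Fin d → ℤ, Antitone w ∧ (∀ i, 0 ≤ w i ∧ w i ≤ J) ∧ (∃ i, w i = J) ∧ F x ≤ F w := by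
  obtain ⟨τ, hanti, hnn, -, habs⟩ := exists_spAct_sorted x
  set y := spAct τ x with hydef
  refine ⟨fun μ => min (y μ) J, hanti.min antitone_const,
    fun μ => ⟨le_min (hnn μ) hJ, min_le_right _ _⟩, ?_, ?_⟩
  · obtain ⟨i, hi⟩ := hx
    refine ⟨τ.1.symm i, min_eq_right ?_⟩
    rw [habs, Equiv.apply_symm_apply]
    exact hi.le
  · set z : Fin d → ℤ := fun μ => max (y μ - J) 0 with hz
    have hyz : y = (fun μ => min (y μ) J) + z := by
      funext μ
      simp only [Pi.add_apply, hz]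
      rcases le_total (y μ) J with h | h
      · rw [min_eq_left h, max_eq_right (by linarith)]; ring
      · rw [min_eq_right h, max_eq_left (by linarith)]; ring
    have hza : Antitone z := by
      intro μ ν hμν
      simp only [hz]
      exact max_le_max (sub_le_sub_right (hanti hμν) J) le_rfl
    rw [← hI τ x]
    calc F y = F ((fun μ => min (y μ) J) + z) := by rw [← hyz]
      _ ≤ F (fun μ => min (y μ) J) :=
        hF _ _ (hanti.min antitone_const) (fun μ => le_min (hnn μ) hJ) hza
          (fun μ => le_max_right _ _)

/-! ### §5  Instantiation: `W_{n,j}`, `L_n`, `K_{n,m+j}` -/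

/-- `sup_{x ≠ 0} W_{n,j} ≤ max_{1 ≤ r ≤ d} W_{n,j}(1^r)`. [cite: HaraSlade1992b, App. B, Lemma B.4] -/
theorem srwW_le_of_onesBounds {n : ℕ} (hn : 1 ≤ n) (hd : 2 * n + 1 ≤ d) (j : ℕ) (B : ℝ)
    (hB : ∀ r : ℕ, 1 ≤ r → r ≤ d → srwW d n j (classVec d r 0) ≤ B)
    (x : Fin d → ℤ) (hx : x ≠ 0) : srwW d n j x ≤ B :=
  le_of_onesBounds _ (spInvariant_srwW n j) (sortedAntitone_srwW hn hd j) B hB x hx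

/-- `sup_{‖x‖₁ ≥ 2} W_{n,j} ≤ max(W_{n,j}(2e₁), max_{2 ≤ r ≤ d} W_{n,j}(1^r))` — the finite-node form
of [NoBLE17] (5.2.40)/p. 1096. [cite: FitznerVanDerHofstad2016NoBLE, §5.2 p. 1096] -/
theorem srwW_le_of_nodeBounds_two {n : ℕ} (hn : 1 ≤ n) (hd : 2 * n + 1 ≤ d) (j : ℕ) (B : ℝ)
    (h2 : srwW d n j (vecOfParts d [2]) ≤ B)
    (hB : ∀ r : ℕ, 2 ≤ r → r ≤ d → srwW d n j (classVec d r 0) ≤ B)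
    (x : Fin d → ℤ) (hx : 2 ≤ ∑ j, |x j|) : srwW d n j x ≤ B :=
  le_of_nodeBounds_two _ (spInvariant_srwW n j) (sortedAntitone_srwW hn hd j) B h2 hB x hx

/-- `sup_Q W_{n,j} ≤ max(W(3e₁), W(2e₁+e₂), W(2e₁+2e₂), max_{3 ≤ r ≤ d} W(1^r))`.
[cite: FitznerVanDerHofstad2016NoBLE, §5.1 p. 1093] -/
theorem srwW_le_of_nodeBounds_three {n : ℕ} (hn : 1 ≤ n) (hd : 2 * n + 1 ≤ d) (j : ℕ) (B : ℝ)
    (h3 : srwW d n j (vecOfParts d [3]) ≤ B) (h21 : srwW d n j (vecOfParts d [2, 1]) ≤ B)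
    (h22 : srwW d n j (vecOfParts d [2, 2]) ≤ B)
    (hB : ∀ r : ℕ, 3 ≤ r → r ≤ d → srwW d n j (classVec d r 0) ≤ B)
    (x : Fin d → ℤ) (hx : 3 ≤ ∑ j, |x j|) : srwW d n j x ≤ B :=
  le_of_nodeBounds_three _ (spInvariant_srwW n j) (sortedAntitone_srwW hn hd j) B h3 h21 h22 hB x
    hx

/-- `sup_{x ≠ 0} L_n ≤ max_{1 ≤ r ≤ d} L_n(1^r)`. [cite: HaraSlade1992b, App. B, Lemma B.4] -/
theorem srwL_le_of_onesBounds {n : ℕ} (hn : 1 ≤ n) (hd : 2 * n + 1 ≤ d) (B : ℝ)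
    (hB : ∀ r : ℕ, 1 ≤ r → r ≤ d → srwL d n (classVec d r 0) ≤ B)
    (x : Fin d → ℤ) (hx : x ≠ 0) : srwL d n x ≤ B :=
  le_of_onesBounds _ (spInvariant_srwL n) (sortedAntitone_srwL hn hd) B hB x hx

/-- `sup_{‖x‖₁ ≥ 2} L_n ≤ max(L_n(2e₁), max_{2 ≤ r ≤ d} L_n(1^r))`.
[cite: FitznerVanDerHofstad2016NoBLE, §5.2 p. 1096] -/
theorem srwL_le_of_nodeBounds_two {n : ℕ} (hn : 1 ≤ n) (hd : 2 * n + 1 ≤ d) (B : ℝ)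
    (h2 : srwL d n (vecOfParts d [2]) ≤ B)
    (hB : ∀ r : ℕ, 2 ≤ r → r ≤ d → srwL d n (classVec d r 0) ≤ B)
    (x : Fin d → ℤ) (hx : 2 ≤ ∑ j, |x j|) : srwL d n x ≤ B :=
  le_of_nodeBounds_two _ (spInvariant_srwL n) (sortedAntitone_srwL hn hd) B h2 hB x hx

/-- **`sup_Q L_n`** ([NoBLE17] p. 1093, with the full node family):
`sup_{‖x‖₁ ≥ 3} L_n ≤ max(L_n(3e₁), L_n(2e₁+e₂), L_n(2e₁+2e₂), max_{3 ≤ r ≤ d} L_n(1^r))`.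
[cite: FitznerVanDerHofstad2016NoBLE, §5.1 p. 1093] -/
theorem srwL_le_of_nodeBounds_three {n : ℕ} (hn : 1 ≤ n) (hd : 2 * n + 1 ≤ d) (B : ℝ)
    (h3 : srwL d n (vecOfParts d [3]) ≤ B) (h21 : srwL d n (vecOfParts d [2, 1]) ≤ B)
    (h22 : srwL d n (vecOfParts d [2, 2]) ≤ B)
    (hB : ∀ r : ℕ, 3 ≤ r → r ≤ d → srwL d n (classVec d r 0) ≤ B)
    (x : Fin d → ℤ) (hx : 3 ≤ ∑ j, |x j|) : srwL d n x ≤ B :=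
  le_of_nodeBounds_three _ (spInvariant_srwL n) (sortedAntitone_srwL hn hd) B h3 h21 h22 hB x hx

/-- **`K` on `Q` via the `W`-split** ([NoBLE17] (5.28)–(5.29)): if `B` bounds `W_{n,j}` at the
`Q`-nodes `3e₁, 2e₁+e₂, 2e₁+2e₂, 1^r (3 ≤ r ≤ d)`, then for every `x` with `‖x‖₁ ≥ 3`,
`K_{n,m+j}(x) ≤ √I_{n,2m}(0) · √B`. [cite: FitznerVanDerHofstad2016NoBLE, (5.28)–(5.29) p. 1093] -/
theorem srwK_le_of_nodeBounds_three {n : ℕ} (hn : 1 ≤ n) (hd : 2 * n + 1 ≤ d) (m j : ℕ) (B : ℝ)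
    (h3 : srwW d n j (vecOfParts d [3]) ≤ B) (h21 : srwW d n j (vecOfParts d [2, 1]) ≤ B)
    (h22 : srwW d n j (vecOfParts d [2, 2]) ≤ B)
    (hB : ∀ r : ℕ, 3 ≤ r → r ≤ d → srwW d n j (classVec d r 0) ≤ B)
    (x : Fin d → ℤ) (hx : 3 ≤ ∑ j, |x j|) :
    srwK d n (m + j) x ≤ Real.sqrt (srwI d n (2 * m) 0) * Real.sqrt B :=
  srwK_le_sqrt_of_srwW_le hd m j x (srwW_le_of_nodeBounds_three hn hd j B h3 h21 h22 hB x hx)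

/-- **`K` on `‖x‖₁ ≥ 2` via the `W`-split**: nodes `2e₁`, `1^r (2 ≤ r ≤ d)` for `W_{n,j}` give
`K_{n,m+j}(x) ≤ √I_{n,2m}(0) · √B`. [cite: FitznerVanDerHofstad2016NoBLE, (5.28)–(5.29) p. 1093] -/
theorem srwK_le_of_nodeBounds_two {n : ℕ} (hn : 1 ≤ n) (hd : 2 * n + 1 ≤ d) (m j : ℕ) (B : ℝ)
    (h2 : srwW d n j (vecOfParts d [2]) ≤ B)
    (hB : ∀ r : ℕ, 2 ≤ r → r ≤ d → srwW d n j (classVec d r 0) ≤ B)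
    (x : Fin d → ℤ) (hx : 2 ≤ ∑ j, |x j|) :
    srwK d n (m + j) x ≤ Real.sqrt (srwI d n (2 * m) 0) * Real.sqrt B :=
  srwK_le_sqrt_of_srwW_le hd m j x (srwW_le_of_nodeBounds_two hn hd j B h2 hB x hx)

end Literature.Probability.FitznerVanDerHofstad2017
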